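import Summits.HodgeConjecture.HodgeConjecture.Theorems.WeilTypeLadderRankTwoCMField
import HarnessLib

/-!
# WeilTypeLadder · the rung bodies R∞ and R1′ on the rank-two-CM-field (type II) loci — unconditional

b2b cell `hweil` (packet `run/shared/lean/b2b/hodge-weil/`, `b2b-hweil-pv3-g36/TYPE-II-LOCI.md`; prover 3). Sibling of
`Theorems/WeilTypeLadderRankTwoCMField.lean`, whose MAIN THEOREM
`weilClassesOf_le_algebraicClasses_of_rankTwoCMField` (for `A` of dimension `2n` with `φ ≫ φ = -d`, `θ` generating a
field `E = ℚ(θ) ≅ ℚ[T]/(P)` of degree `2n` with `K = ℚ(φ) ⊂ E` and balanced multiplicities: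
`weilClassesOf A φ n d ≤ algebraicClasses A.X n`, NO named fact) is restated here in the LITERAL SHAPE of the ladder's
rungs (`Theorems/WeilTypeLadder.lean`), binders first, extra structure after, so that the census can cite a decl per rung:

* `weilClassesImaginaryQuadratic_rankTwoCMField` — the body of R∞ (`WeilClassesImaginaryQuadratic`: every `n ≥ 2`,
  every `K = ℚ(√-d)`, every discriminant) on the locus; for `n = 4` it covers the simple abelian EIGHTFOLDS of type
  II(4) containing `K`, in split AND non-split components (packet §3.4) — loci of the census rows R2₈ / R2 / R∞;
* `nonsplitSixfolds_rankTwoCMField` — the body of the FIRST RUNG ABOVE THE FLOOR R1′ (`NonsplitSixfolds`; its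
  "no hyperbolic polarization" binder carried unused) on the locus: by the packet's THEOREM DISC-II every non-split
  sixfold component of every `K` contains such 3-dimensional families of SIMPLE type-II(3) sixfolds;
* `…_of_hodgeConjecture` — the on-path lemmas (`HodgeConjecture →` the same statements), via
  `WeilTypeLadderOnPath`.

HONEST LABEL: CASES of the rungs on proper sub-loci, not rungs; unconditional (Lefschetz `(1,1)` only, all inputs proved
in the tree); the algebraicity is in print (Moonen–Zarhin 1998, second Criterion: Weil classes of subfields of `End⁰`
of type I/II abelian varieties are decomposable); 0 unconditional rungs above the floor are added; no statement of
Markman's papers is used.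
-/

noncomputable section

-- every declaration of this problem lives in `Summit.HodgeConjecture.HodgeConjecture.…` (summit = sub-problem)
set_option linter.dupNamespace false

open CategoryTheory
open Literature.AlgebraicGeometry Literature.AlgebraicGeometry.Motives
open Literature.AlgebraicGeometry.HodgeTheory
open Literature.AlgebraicTopology.SingularHomology

namespace Summit.HodgeConjecture.HodgeConjecture.WeilTypeLadder

section RankTwoCMFieldRungs

/-- **R∞ on the locus (every `n ≥ 2`, every `K = ℚ(√-d)`).** The literal body of the rung
`WeilTypeLadder.WeilClassesImaginaryQuadratic` — every rational `(n,n)`-class of `weilClassesOf A φ n d` is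
algebraic — for the abelian `2n`-folds `(A, φ)` carrying, in addition, an endomorphism `θ` generating a field
`E = ℚ(θ) ≅ ℚ[T]/(P)` of degree `2n` with `K = ℚ(φ) ⊂ E` (`N • φ = S(θ)`) and balanced multiplicities. For
`n = 4` these include the simple abelian EIGHTFOLDS of type II(4) (`End⁰ ⊇` a totally indefinite quaternion
algebra over a totally real quartic field containing `K`), in EVERY discriminant class — split and non-split
(packet `TYPE-II-LOCI.md`, THEOREM DISC-II). Unconditional; no named fact.
[cite: MoonenZarhin1998WeilClasses, §1–§2] [cite: vanGeemen1994HodgeAV, 4.9] -/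
theorem weilClassesImaginaryQuadratic_rankTwoCMField :
    ∀ (n : ℕ), 2 ≤ n → ∀ (d : ℕ), 0 < d → ∀ (A : AbelianVariety ℂ) (φ : A ⟶ A), A.dim = 2 * n →
      IsSmoothProjective (2 * n) A.X → φ ≫ φ = -(d • 𝟙 A) →
      ∀ (θ : A ⟶ A) (P S : Polynomial ℤ) (N : ℕ), P.Monic → P.natDegree = 2 * n →
        Irreducible (P.map (Int.castRingHom ℚ)) →
        Polynomial.eval₂ (Int.castRingHom (CategoryTheory.End A)) (θ : CategoryTheory.End A) P = 0 →
        0 < N →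
        ((N • φ : A ⟶ A) : CategoryTheory.End A) =
          Polynomial.eval₂ (Int.castRingHom (CategoryTheory.End A)) (θ : CategoryTheory.End A) S →
        (∀ ρ : ℂ, Polynomial.eval₂ (Int.castRingHom ℂ) ρ P = 0 →
          eigenMultiplicity A θ ρ = eigenMultiplicity A θ (starRingEnd ℂ ρ)) →
      ∀ c : complexBetti A.X (2 * n), IsRationalClass c → IsOfHodgeType (2 * n) A.X (2 * n) n n c →
        c ∈ weilClassesOf A φ n d → c ∈ algebraicClasses A.X n := by
  intro n hn d hd A φ hA _ hφ θ P S N hPm hPe hPirr hθ hN hS hbal c _ _ hW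
  exact weilClassesOf_le_algebraicClasses_of_rankTwoCMField (by omega) hd hA hφ hPm hPe hPirr hθ hN hS
    hbal hW

/-- **On-path lemma (R∞ shape)**: the Hodge conjecture implies the same statement on the locus
(`HodgeConjecture → WeilClassesImaginaryQuadratic →` the locus; the extra structure is not used). -/
theorem weilClassesImaginaryQuadratic_rankTwoCMField_of_hodgeConjecture (h : _root_.HodgeConjecture) :
    ∀ (n : ℕ), 2 ≤ n → ∀ (d : ℕ), 0 < d → ∀ (A : AbelianVariety ℂ) (φ : A ⟶ A), A.dim = 2 * n →
      IsSmoothProjective (2 * n) A.X → φ ≫ φ = -(d • 𝟙 A) →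
      ∀ (θ : A ⟶ A) (P S : Polynomial ℤ) (N : ℕ), P.Monic → P.natDegree = 2 * n →
        Irreducible (P.map (Int.castRingHom ℚ)) →
        Polynomial.eval₂ (Int.castRingHom (CategoryTheory.End A)) (θ : CategoryTheory.End A) P = 0 →
        0 < N →
        ((N • φ : A ⟶ A) : CategoryTheory.End A) =
          Polynomial.eval₂ (Int.castRingHom (CategoryTheory.End A)) (θ : CategoryTheory.End A) S →
        (∀ ρ : ℂ, Polynomial.eval₂ (Int.castRingHom ℂ) ρ P = 0 →
          eigenMultiplicity A θ ρ = eigenMultiplicity A θ (starRingEnd ℂ ρ)) →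
      ∀ c : complexBetti A.X (2 * n), IsRationalClass c → IsOfHodgeType (2 * n) A.X (2 * n) n n c →
        c ∈ weilClassesOf A φ n d → c ∈ algebraicClasses A.X n :=
  fun n hn d hd A φ hA hX hφ _ _ _ _ _ _ _ _ _ _ _ c hc hnn hW ↦
    weilClassesImaginaryQuadratic_of_hodgeConjecture h n hn d hd A φ hA hX hφ c hc hnn hW

/-- **R1′ on the locus (`n = 3`): Weil classes on the rank-two-CM-field SIXFOLDS are algebraic — whatever the
discriminant.** The literal body of the first rung above the floor, `WeilTypeLadder.NonsplitSixfolds` (NON-split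
Weil sixfolds: no `K`-symmetrised hyperplane class is hyperbolic — binder carried, unused), for the abelian
sixfolds `(A, φ)` with a sextic field `E = ℚ(θ) ⊃ K` acting with `E`-rank `2` and balanced multiplicities: the
simple abelian sixfolds of type II(3) (`End⁰(A) = D` a totally indefinite quaternion algebra over a totally real
cubic field `F₀`, `E = K·F₀ ⊂ D`; a `3`-dimensional Shimura family for each `D ∋ K`) and their degenerations. By
the packet's THEOREM DISC-II such a sixfold with `D ≅ (-d, u)_{F₀}` has discriminant class `-N_{F₀/ℚ}(u)`, and
for `u = c ∈ ℚ_{>0}`, `c ∉ Nm(K^×)`, `D = (-d, c)_ℚ ⊗ F₀` is a division algebra for EVERY totally real cubic `F₀`: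
EVERY non-split component of EVERY `K` contains such `3`-dimensional loci of SIMPLE sixfolds — the first
unconditional (Lefschetz-only), kernel-checked, positive-dimensional SIMPLE loci inside R1′ in the cell's census.
A CASE of R1′ on a proper sublocus, not the rung. Unconditional; no named fact.
[cite: MoonenZarhin1998WeilClasses, §1–§2] [cite: Markman2025SurveySecant, §1.1 (non-split sixfolds open)] -/
theorem nonsplitSixfolds_rankTwoCMField :
    ∀ (d : ℕ), 0 < d → ∀ (A : AbelianVariety ℂ) (φ : A ⟶ A), A.dim = 2 * 3 →
      IsSmoothProjective (2 * 3) A.X → φ ≫ φ = -(d • 𝟙 A) →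
      ∀ (θ : A ⟶ A) (P S : Polynomial ℤ) (N : ℕ), P.Monic → P.natDegree = 2 * 3 →
        Irreducible (P.map (Int.castRingHom ℚ)) →
        Polynomial.eval₂ (Int.castRingHom (CategoryTheory.End A)) (θ : CategoryTheory.End A) P = 0 →
        0 < N →
        ((N • φ : A ⟶ A) : CategoryTheory.End A) =
          Polynomial.eval₂ (Int.castRingHom (CategoryTheory.End A)) (θ : CategoryTheory.End A) S →
        (∀ ρ : ℂ, Polynomial.eval₂ (Int.castRingHom ℂ) ρ P = 0 →
          eigenMultiplicity A θ ρ = eigenMultiplicity A θ (starRingEnd ℂ ρ)) →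
      (∀ (e : ProjectiveEmbedding A.X) (a : complexBetti (projectiveSpace e.n ℂ) 2),
        IsRationalClass a → a ≠ 0 →
          ¬ IsHyperbolicWeilType A φ 3
            ((d : ℂ) • complexBetti.map e.ι 2 a + complexBetti.map φ.hom.hom.hom 2 (complexBetti.map e.ι 2 a))) →
      ∀ c : complexBetti A.X (2 * 3), IsRationalClass c → IsOfHodgeType (2 * 3) A.X (2 * 3) 3 3 c →
        c ∈ weilClassesOf A φ 3 d → c ∈ algebraicClasses A.X 3 := by
  intro d hd A φ hA _ hφ θ P S N hPm hPe hPirr hθ hN hS hbal _ c _ _ hW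
  exact weilClassesOf_le_algebraicClasses_of_rankTwoCMField (by norm_num) hd hA hφ hPm hPe hPirr hθ hN hS
    hbal hW

/-- **On-path lemma (R1′ shape)**: the Hodge conjecture implies the same statement on the sixfold locus
(`HodgeConjecture → NonsplitSixfolds →` the locus). -/
theorem nonsplitSixfolds_rankTwoCMField_of_hodgeConjecture (h : _root_.HodgeConjecture) :
    ∀ (d : ℕ), 0 < d → ∀ (A : AbelianVariety ℂ) (φ : A ⟶ A), A.dim = 2 * 3 →
      IsSmoothProjective (2 * 3) A.X → φ ≫ φ = -(d • 𝟙 A) →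
      ∀ (θ : A ⟶ A) (P S : Polynomial ℤ) (N : ℕ), P.Monic → P.natDegree = 2 * 3 →
        Irreducible (P.map (Int.castRingHom ℚ)) →
        Polynomial.eval₂ (Int.castRingHom (CategoryTheory.End A)) (θ : CategoryTheory.End A) P = 0 →
        0 < N →
        ((N • φ : A ⟶ A) : CategoryTheory.End A) =
          Polynomial.eval₂ (Int.castRingHom (CategoryTheory.End A)) (θ : CategoryTheory.End A) S →
        (∀ ρ : ℂ, Polynomial.eval₂ (Int.castRingHom ℂ) ρ P = 0 →
          eigenMultiplicity A θ ρ = eigenMultiplicity A θ (starRingEnd ℂ ρ)) →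
      (∀ (e : ProjectiveEmbedding A.X) (a : complexBetti (projectiveSpace e.n ℂ) 2),
        IsRationalClass a → a ≠ 0 →
          ¬ IsHyperbolicWeilType A φ 3
            ((d : ℂ) • complexBetti.map e.ι 2 a + complexBetti.map φ.hom.hom.hom 2 (complexBetti.map e.ι 2 a))) →
      ∀ c : complexBetti A.X (2 * 3), IsRationalClass c → IsOfHodgeType (2 * 3) A.X (2 * 3) 3 3 c →
        c ∈ weilClassesOf A φ 3 d → c ∈ algebraicClasses A.X 3 :=
  fun d hd A φ hA hX hφ _ _ _ _ _ _ _ _ _ _ _ hnon c hc h33 hW ↦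
    nonsplitSixfolds_of_hodgeConjecture h d hd A φ hA hX hφ hnon c hc h33 hW

end RankTwoCMFieldRungs

end Summit.HodgeConjecture.HodgeConjecture.WeilTypeLadder

end
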